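import Summits.HodgeConjecture.HodgeConjecture.Theorems.Ring2HypothesesMTAnchorsSeparatedBase
import Summits.HodgeConjecture.HodgeConjecture.Theorems.Ring2DeformCMPivotAnchors
import Summits.HodgeConjecture.HodgeConjecture.Theorems.AnchorTransportVariationalHodgeQuasiProjective
import Literature.AlgebraicGeometry.Motives.AbelianSchemeProjective
import Literature.AlgebraicGeometry.Motives.ConstantFamilyFibre
import Literature.AlgebraicGeometry.HodgeTheory.ZariskiClosedNowhereDense
import HarnessLib

/-!
# Ring 2 — hypotheses layer: row b01 over separated bases ⟹ row b07 (`CMAnchoredFamilies`) modulo Raynaud,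
# and ⟺ modulo Raynaud + Catanese

HONEST FRAMING (page 1, verbatim the cell's standing line): **research route conditional on HC_CM; not a
corollary; Q11.4-sentence-2 already refuted in dim ≥ 3.** Nothing in this file proves a case of the Hodge
conjecture. `HC_CM` (`Theses.RankFourFaces.CMAbelianHodge`) plays no role here and is never restated.

Cell `pub-hodge-ring2`, binder seat `ring2-b01` (gen 9), rows b01 `MumfordTateCMAnchors` (`Ring2Hypotheses.lean`
§1b) and b07 `CMAnchoredFamilies` (`Ring2HypothesesCMPivot.lean`) of `BINDER-OWNERS.md`, both kind CITE. Part XX of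
the deform axis (`Ring2DeformCMPivotAnchors`) proved `CMAnchoredFamilies ⟹ MumfordTateCMAnchors` modulo Catanese
2002 and recorded (honest column (1)) that the converse "is NOT derivable as typed: the family produced by
`MumfordTateCMAnchors` carries no quasi-projectivity of `𝒳` or `S`". This part proves the converse OVER SEPARATED
BASES modulo ONE booked Literature named fact, `Motives.raynaud1970_abelianScheme_section_projective`
(`Motives/AbelianSchemeProjective.lean`, p143462; displayed by row b02's `Ring2BindersAbelianSchemeVHCRaynaud`): a
smooth proper morphism WITH A SECTION over a smooth affine `ℂ`-scheme whose complex fibres are abelian varieties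
is H-projective over the base (Laurent–Schröer 2023 Prop. 4.3 with Görtz–Wedhorn II Thm. 27.291 = Raynaud 1970,
LNM 119, XI 1.4). A HYPOTHESIS `hR` wherever used; not discharged.

CONSTRUCTION (engine `cmAnchoredFor_of_sepAnchors_of_raynaud1970`). Given the b01 data over a smooth irreducible
separated `S` — `f : 𝒳 ⟶ S`, chart `e : A ≅ 𝒳_{s₁}`, global class `W` fibrewise rational `(p,p)` with
`e^*(W|_{𝒳_{s₁}}) = c`, CM fibre `A₀ ≅ 𝒳_{s₀}` — Raynaud's theorem wants a SECTION, which `f` need not have. The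
device is Mumford's two-point lemma (*Abelian Varieties* §6) applied to the TOTAL SPACE: (1) thicken the base,
`T := ℙ¹ × S ⟶ S`, so that the two marked fibres acquire DISTINCT points even when `s₁ = s₀` (`T` is irreducible
as the total space of the smooth projective family `ℙ¹ × S ⟶ S`, `irreducibleSpace_of_isSmoothProjectiveFamily`);
(2) the total space `Y` of `𝒳 ×_S T ⟶ T` is irreducible, smooth, separated over `ℂ`; pick `y₁, y₀ ∈ Y(ℂ)` over
`(q₀, s₁) ≠ (q₁, s₀)`; (3) the tree THEOREM `Motives.mumford_smoothCurve_through_two_points_of_isSeparated_of_smooth`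
(Chow's lemma + the affine case) gives a smooth irreducible affine curve `γ : D ⟶ Y` through `y₁`, `y₀`;
(4) base-change `f` along `h := γ ≫ pr_𝒳 ≫ f : D ⟶ S`: the family `𝒳 ×_S D ⟶ D` HAS A SECTION (the graph of
`γ ≫ pr_𝒳`, `familyPullback.isPullback`), its fibres are fibres of `f`, and `h(a) = s₁`, `h(b) = s₀`; (5) Raynaud
makes `𝒳 ×_S D ↪ ℙᴺ × D` a closed `D`-immersion, so the total space is quasi-projective over `ℂ`
(`Theorems.isQuasiProjectiveOver_of_isClosedImmersion_of_isAffine`), as is the affine curve `D`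
(`IsQuasiProjectiveOver.of_isAffine`); (6) chart, anchor, the fibrewise rational `(p,p)` clause on every abelian
presentation of a fibre and the CM fibre move along `fiberOverFamilyPullbackIso` (`isRationalClass_map_iff_of_iso`,
`isOfHodgeType_map_iff_of_iso`, `schemeDim_eq_holds`); the CM typings agree by `isCM_iff_exists_cmSubalgebra`.

RESULTS. §1 transport lemmas; §2 the engine; §3 **`cmAnchoredFamilies_of_mtAnchorsSep_of_raynaud1970 :
hR → MTAnchorsSep[] → CMAnchoredFamilies`** and **`cmAnchoredFamilies_of_mtFlatSep_of_raynaud1970`** (through row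
b01's curve form, gen 8's `mtAnchorsCurve_iff_sep` / `mtAnchorsCurve_iff_flatSep`): `CMAnchoredFamilies` ⟸
Charles–Schnell Thm. 11.5.11 (a) + flat-section (b) + ONE CM fibre over a separated base + Raynaud XI 1.4 — the
quasi-projectivity clauses of b07's print (Baily–Borel; Borel 1972, 3.10; Cattani–Deligne–Kaplan in the proof of
CS 11.5.11), the density of CM points and the global invariant cycle theorem leave row b07's kernel input once
Raynaud is granted; §4 the converse keeping separatedness (part XX (C) + `IsQuasiProjectiveOver.isSeparated`) and
**`mtAnchorsSep_iff_cmAnchoredFamilies_of_raynaud1970_of_catanese2002 : MTAnchorsSep[] ↔ CMAnchoredFamilies`**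
(also `MTFlatSep[] ↔`): rows b01 (separated bases) and b07 are ONE ROW modulo the two booked facts.

HONEST COLUMN. (1) CONDITIONAL results: Raynaud (`hR`, §2–§4) and Catanese (`hCat`, §4) are refereed Literature
named facts taken as hypotheses; neither is discharged; no NEW fact (net literature debt 0). (2)
`MumfordTateCMAnchors` AS TYPED (base possibly non-separated over `ℂ`) is not shown to imply `CMAnchoredFamilies`;
the residual is the typing artefact recorded in `Ring2HypothesesMTAnchorsSeparatedBase`. (3) No definition, no
`sorry`; notations are file-local. (4) Rows b01, b07 stay KIND CITE; «10 · 0» untouched; no case of HC.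

References: [MumfordAV1970] §6, §22; [GortzWedhorn2023] Thm. 27.291 (= [Raynaud1970] XI 1.4); [LaurentSchroer2023]
Prop. 4.3; [Catanese2002DeformationTypes] Thm. 4.1/4.6; [CharlesSchnell2014Notes] Thm. 11.5.11; [Hartshorne1977] II §3–4.
-/

-- every declaration of this problem lives in `Summit.HodgeConjecture.HodgeConjecture.…` (summit = sub-problem)
set_option linter.dupNamespace false

noncomputable section

open CategoryTheory AlgebraicGeometry Topology MonoidalCategory
open Literature.AlgebraicGeometry Literature.AlgebraicGeometry.Motives Literature.AlgebraicGeometry.HodgeTheory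
open Literature.AlgebraicGeometry.Deligne1982 (cmLocus deligne1982_cmDenseMumfordTateFamilies)
open Summit.HodgeConjecture.HodgeConjecture.Theorems.HodgeAbelianVarieties.CMPivot (isCM_iff_exists_cmSubalgebra)

namespace Summit.HodgeConjecture.HodgeConjecture.Ring2.Hypotheses

/-! ## §0 File-local notations (no definition is introduced): `IsCM[·]`, `QProj[·]`, `FibreIncl[·]`,
`HodgeAlong[·]` byte for byte from `Ring2HypothesesCMPivot` (so `CMAnchoredFamilies` unfolds to them);
`MTAnchorsSep[]`, `MTFlatSep[]` byte for byte from `Ring2HypothesesMTAnchorsSeparatedBase`; `SepAnchorsFor[A, p, c]`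
/ `CMAnchoredFor[A, p, c]` name the one-class bodies. -/

/-- `IsCM[A]` — CM type in the eigenvalue typing (verbatim the CM-pivot notation). Local notation only. -/
local notation3 (prettyPrint := false) "IsCM[" A "]" =>
  ∃ (ψ : A ⟶ A) (μ : Fin (2 * AbelianVariety.dim A) → ℂ), Function.Injective μ ∧
    ∀ i, Module.End.HasEigenvalue (HodgeTheory.complexBetti.map ψ.hom.hom.hom 1).hom (μ i)

/-- `QProj[X]` — `X` quasi-projective over `ℂ` (body of `HodgeTheory.IsQuasiProjectiveOver X`). Local notation. -/
local notation3 (prettyPrint := false) "QProj[" X "]" =>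
  ∃ (P : SchemeOver ℂ) (j : X ⟶ P), IsProjectiveOver P ∧ AlgebraicGeometry.IsOpenImmersion j.left

/-- `FibreIncl[f, B, e, s]` — `e` presents `B` as the fibre of `f` over `s`. Local notation only. -/
local notation3 (prettyPrint := false) "FibreIncl[" f ", " B ", " e ", " s "]" =>
  ∃ i : AbelianVariety.X B ≅ fiberOver f s, e = CategoryStruct.comp i.hom (fiberι f s)

/-- `HodgeAlong[S, 𝒳, f, G, p]` — `G` is rational `(p,p)` on every fibre presented as an abelian variety. -/
local notation3 (prettyPrint := false) "HodgeAlong[" S ", " 𝒳 ", " f ", " G ", " p "]" =>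
  ∀ (B : AbelianVariety ℂ) (eB : AbelianVariety.X B ⟶ 𝒳) (u : ComplexPoints S),
    FibreIncl[f, B, eB, u] →
      HodgeTheory.IsRationalClass (HodgeTheory.complexBetti.map eB (2 * p) G) ∧
      HodgeTheory.IsOfHodgeType B.dim B.X (2 * p) p p (HodgeTheory.complexBetti.map eB (2 * p) G)

/-- `CMAnchoredFor[A, p, c]` — the body of `CMAnchoredFamilies` for ONE class `c ∈ H^{2p}(A(ℂ); ℂ)` (quasi-projective
base and total space, `A` the fibre at `t`, a CM fibre at `s₀`, a global class `G` with `e^* G = c`). Local notation. -/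
local notation3 (prettyPrint := false) "CMAnchoredFor[" A ", " p ", " c "]" =>
  ∃ (S 𝒳 : SchemeOver ℂ) (f : 𝒳 ⟶ S) (G : HodgeTheory.complexBetti 𝒳 (2 * p))
    (t s₀ : ComplexPoints S) (e : AbelianVariety.X A ⟶ 𝒳) (A₀ : AbelianVariety ℂ) (e₀ : A₀.X ⟶ 𝒳),
    QProj[𝒳] ∧ QProj[S] ∧ AlgebraicGeometry.Smooth S.hom ∧ IrreducibleSpace S.left ∧
    IsSmoothProjectiveFamily f (AbelianVariety.dim A) ∧
    FibreIncl[f, A, e, t] ∧ FibreIncl[f, A₀, e₀, s₀] ∧ IsCM[A₀] ∧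
    HodgeTheory.complexBetti.map e (2 * p) G = c ∧ HodgeAlong[S, 𝒳, f, G, p]

/-- `SepAnchorsFor[A, p, c]` — the body of `MumfordTateCMAnchors` for ONE class, base SEPARATED over `ℂ`. -/
local notation3 (prettyPrint := false) "SepAnchorsFor[" A ", " p ", " c "]" =>
  ∃ (𝒳 S : SchemeOver ℂ) (f : 𝒳 ⟶ S) (s₁ s₀ : ComplexPoints S) (e : AbelianVariety.X A ≅ fiberOver f s₁)
    (W : complexBetti 𝒳 (2 * p)) (A₀ : AbelianVariety ℂ),
    IsSmoothProjectiveFamily f (AbelianVariety.dim A) ∧ IrreducibleSpace S.left ∧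
    AlgebraicGeometry.Smooth S.hom ∧ IsSeparated S.hom ∧
    (∀ s : ComplexPoints S, ∃ A' : AbelianVariety ℂ,
      A'.dim = AbelianVariety.dim A ∧ Nonempty (A'.X ≅ fiberOver f s)) ∧
    (∀ s : ComplexPoints S, IsRationalClass (complexBetti.map (fiberι f s) (2 * p) W) ∧
      IsOfHodgeType (AbelianVariety.dim A) (fiberOver f s) (2 * p) p p
        (complexBetti.map (fiberι f s) (2 * p) W)) ∧
    complexBetti.map e.hom (2 * p) (complexBetti.map (fiberι f s₁) (2 * p) W) = c ∧
    A₀.dim = AbelianVariety.dim A ∧ Nonempty (A₀.X ≅ fiberOver f s₀) ∧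
    (∃ E : Subalgebra ℚ A₀.endAlgebra, IsReduced ↥E ∧ (∀ x ∈ E, ∀ y ∈ E, x * y = y * x) ∧
      Module.finrank ℚ ↥E = 2 * A₀.dim)

/-- `MTAnchorsSep[]` — `MumfordTateCMAnchors` with the base SEPARATED over `ℂ` (gen 8's notation). -/
local notation3 (prettyPrint := false) "MTAnchorsSep[]" =>
  ∀ (A : AbelianVariety ℂ), IsSmoothProjective A.dim A.X →
    ∀ (p : ℕ) (c : complexBetti A.X (2 * p)), IsRationalClass c →
      IsOfHodgeType A.dim A.X (2 * p) p p c → SepAnchorsFor[A, p, c]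

/-- `MTFlatSep[]` — Charles–Schnell Thm. 11.5.11 (a) with (b) in FLAT-SECTION form and ONE CM point over a smooth
irreducible SEPARATED base (gen 8's notation, verbatim). -/
local notation3 (prettyPrint := false) "MTFlatSep[]" =>
  ∀ (A : AbelianVariety ℂ), IsSmoothProjective A.dim A.X →
    ∀ (p : ℕ) (c : complexBetti A.X (2 * p)), IsRationalClass c →
      IsOfHodgeType A.dim A.X (2 * p) p p c →
        ∃ (𝒳 S : SchemeOver ℂ) (f : 𝒳 ⟶ S) (σ : ComplexPoints S → FiberClass f (2 * p))
          (s₁ : ComplexPoints S) (e : A.X ≅ fiberOver f s₁) (s₀ : ComplexPoints S),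
          IsSmoothProjectiveFamily f A.dim ∧ IrreducibleSpace S.left ∧ AlgebraicGeometry.Smooth S.hom ∧
          IsSeparated S.hom ∧
          (∀ s : ComplexPoints S, ∃ A' : AbelianVariety ℂ, A'.dim = A.dim ∧ Nonempty (A'.X ≅ fiberOver f s)) ∧
          Continuous σ ∧ (∀ s, (σ s).pt = s) ∧ (∀ s, σ s ∈ locusOfHodgeClasses f A.dim p) ∧
          σ s₁ = ⟨s₁, complexBetti.map e.inv (2 * p) c⟩ ∧
          s₀ ∈ cmLocus f A.dim

/-! ## §1 Classes pulled back to a base change: fibre values, anchors, the fibrewise Hodge clause -/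

section Transport

variable {𝒳 S S' : SchemeOver ℂ} (f : 𝒳 ⟶ S) (g : S' ⟶ S)

/-- **Fibre values of a pulled-back class.** For `W ∈ H^k(𝒳(ℂ); ℂ)` and `u ∈ S'(ℂ)`, the restriction of
`pr_𝒳^* W` to the fibre of `𝒳 ×_S S' ⟶ S'` over `u` is the restriction of `W` to `𝒳_{g(u)}`, read through
`fiberOverFamilyPullbackIso` (`fiberOverFamilyPullbackIso_hom_fiberι`). [cite: Hartshorne1977, II §3 (base extension)] -/
theorem complexBetti_map_fiberι_familyPullback (k : ℕ) (W : complexBetti 𝒳 k) (u : ComplexPoints S') :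
    complexBetti.map (fiberι (familyPullback.snd f g) u) k (complexBetti.map (familyPullback.fst f g) k W) =
      complexBetti.map (fiberOverFamilyPullbackIso f g u).hom k
        (complexBetti.map (fiberι f (AlgPoints.map g u)) k W) := by
  rw [← CategoryTheory.comp_apply, ← complexBetti.map_comp, ← fiberOverFamilyPullbackIso_hom_fiberι,
    complexBetti.map_comp, CategoryTheory.comp_apply]

/-- **The anchor moves to the base change.** If `g(u) = s`, `e : Y ≅ 𝒳_s` and `e^*(W|_{𝒳_s}) = c`, then for
`i := e ≫ (fiberOverFamilyPullbackIso)⁻¹ : Y ≅ (𝒳 ×_S S')_u` one has `(i ≫ ι_u)^*(pr_𝒳^* W) = c`.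
[cite: Hartshorne1977, II §3 (base extension)] -/
theorem exists_anchor_familyPullback_of_map_eq {Y : SchemeOver ℂ} (k : ℕ) (W : complexBetti 𝒳 k)
    {u : ComplexPoints S'} {s : ComplexPoints S} (hu : AlgPoints.map g u = s) (e : Y ≅ fiberOver f s)
    {c : complexBetti Y k} (hc : complexBetti.map e.hom k (complexBetti.map (fiberι f s) k W) = c) :
    ∃ i : Y ≅ fiberOver (familyPullback.snd f g) u,
      complexBetti.map (i.hom ≫ fiberι (familyPullback.snd f g) u) k
        (complexBetti.map (familyPullback.fst f g) k W) = c := by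
  subst hu
  refine ⟨e ≪≫ (fiberOverFamilyPullbackIso f g u).symm, ?_⟩
  have hcomp : ((e ≪≫ (fiberOverFamilyPullbackIso f g u).symm).hom ≫ fiberι (familyPullback.snd f g) u) ≫
      familyPullback.fst f g = e.hom ≫ fiberι f (AlgPoints.map g u) := by
    rw [Iso.trans_hom, Iso.symm_hom, Category.assoc, Category.assoc, ← fiberOverFamilyPullbackIso_hom_fiberι,
      Iso.inv_hom_id_assoc]
  rw [← CategoryTheory.comp_apply, ← complexBetti.map_comp, hcomp, complexBetti.map_comp,
    CategoryTheory.comp_apply, hc]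

/-- **A chart of a fibre moves to the base change**: if `g(u) = s` and `Y ≅ 𝒳_s` then `Y ≅ (𝒳 ×_S S')_u`
(`fiberOverFamilyPullbackIso`). [cite: Hartshorne1977, II §3 (base extension)] -/
theorem nonempty_fiberIso_familyPullback_of_map_eq {Y : SchemeOver ℂ} {u : ComplexPoints S'} {s : ComplexPoints S}
    (hu : AlgPoints.map g u = s) (i : Y ≅ fiberOver f s) : Nonempty (Y ≅ fiberOver (familyPullback.snd f g) u) := by
  subst hu
  exact ⟨i ≪≫ (fiberOverFamilyPullbackIso f g u).symm⟩

/-- **The fibrewise rational `(p,p)` clause moves to every abelian presentation of a fibre of the base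
change.** If `W|_{𝒳_s}` is rational of Hodge type `(p,p)` (dimension parameter `n`) for every `s ∈ S(ℂ)` and
`f` is a smooth projective family of relative dimension `n`, then for every abelian variety `B` presented as a
fibre of `𝒳 ×_S S' ⟶ S'` by `e_B = i ≫ ι_u`, the class `e_B^*(pr_𝒳^* W)` is rational of Hodge type `(p,p)` on
`B` (iso-transport `isRationalClass_map_iff_of_iso` / `isOfHodgeType_map_iff_of_iso` along
`i ≫ fiberOverFamilyPullbackIso : B ≅ 𝒳_{g(u)}`; `dim B = n` by `schemeDim_eq_holds`).
[cite: Hartshorne1977, II §3 (base extension)] [cite: MumfordAV1970, §22] -/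
theorem hodgeAlong_familyPullback {n p : ℕ} (hf : IsSmoothProjectiveFamily f n) (W : complexBetti 𝒳 (2 * p))
    (hW : ∀ s : ComplexPoints S, IsRationalClass (complexBetti.map (fiberι f s) (2 * p) W) ∧
      IsOfHodgeType n (fiberOver f s) (2 * p) p p (complexBetti.map (fiberι f s) (2 * p) W))
    (B : AbelianVariety ℂ) (eB : B.X ⟶ familyPullback f g) (u : ComplexPoints S')
    (heB : ∃ i : B.X ≅ fiberOver (familyPullback.snd f g) u, eB = i.hom ≫ fiberι (familyPullback.snd f g) u) :
    IsRationalClass (complexBetti.map eB (2 * p) (complexBetti.map (familyPullback.fst f g) (2 * p) W)) ∧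
      IsOfHodgeType B.dim B.X (2 * p) p p
        (complexBetti.map eB (2 * p) (complexBetti.map (familyPullback.fst f g) (2 * p) W)) := by
  obtain ⟨i, rfl⟩ := heB
  have hBdim : B.dim = n :=
    schemeDim_eq_holds (((hf.familyPullback_snd g).isSmoothProjective u).of_iso i.symm)
  rw [complexBetti.map_comp, CategoryTheory.comp_apply, complexBetti_map_fiberι_familyPullback,
    ← CategoryTheory.comp_apply, ← complexBetti.map_comp, ← Iso.trans_hom, hBdim]
  exact ⟨(isRationalClass_map_iff_of_iso (i ≪≫ fiberOverFamilyPullbackIso f g u)).2 (hW _).1,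
    (isOfHodgeType_map_iff_of_iso (i ≪≫ fiberOverFamilyPullbackIso f g u)).2 (hW _).2⟩

end Transport

/-! ## §2 The engine: from separated-base anchors to CM-anchored quasi-projective families, modulo Raynaud -/

section Engine

variable {A : AbelianVariety ℂ} {p : ℕ} {c : complexBetti A.X (2 * p)}

/-- **ENGINE — `SepAnchorsFor[A, p, c] ⟹ CMAnchoredFor[A, p, c]` modulo Raynaud 1970** (module docstring,
steps (1)–(6): `ℙ¹`-thickening, Mumford's two-point lemma in the total space, base change to the curve — a family
WITH A SECTION —, Raynaud, transport). CONDITIONAL on `raynaud1970_abelianScheme_section_projective` (displayed,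
not discharged). [cite: MumfordAV1970, §6 Lemma and §22] [cite: GortzWedhorn2023, §(27.53) Thm. 27.291]
[cite: LaurentSchroer2023, §4 Prop. 4.3] [cite: Hartshorne1977, II §3 and II §4 p. 103] -/
theorem cmAnchoredFor_of_sepAnchors_of_raynaud1970 (hR : raynaud1970_abelianScheme_section_projective)
    (h : SepAnchorsFor[A, p, c]) : CMAnchoredFor[A, p, c] := by
  obtain ⟨𝒳, S, f, s₁, s₀, e, W, A₀, hf, hirr, hsm, hsep, hab, hW, hWc, -, ⟨i₀⟩, hcm₀⟩ := h
  haveI := hirr; haveI := hsm; haveI := hsep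
  haveI : LocallyOfFiniteType S.hom := inferInstance
  -- Step 1: thicken the base by `ℙ¹`
  have hP : IsSmoothProjective 1 (projectiveSpace 1 ℂ) := isSmoothProjective_projectiveSpace_holds ℂ 1
  have hπ : IsSmoothProjectiveFamily (CartesianMonoidalCategory.snd (projectiveSpace 1 ℂ) S) 1 :=
    isSmoothProjectiveFamily_snd hP S
  haveI : IrreducibleSpace (projectiveSpace 1 ℂ ⊗ S).left :=
    irreducibleSpace_of_isSmoothProjectiveFamily _ hπ
  haveI : AlgebraicGeometry.Smooth (CartesianMonoidalCategory.snd (projectiveSpace 1 ℂ) S).left := hπ.smooth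
  haveI : IsProper (CartesianMonoidalCategory.snd (projectiveSpace 1 ℂ) S).left := hπ.isProper
  haveI : AlgebraicGeometry.Smooth (projectiveSpace 1 ℂ ⊗ S).hom := by
    rw [← Over.w (CartesianMonoidalCategory.snd (projectiveSpace 1 ℂ) S)]; infer_instance
  haveI : IsSeparated (projectiveSpace 1 ℂ ⊗ S).hom := by
    rw [← Over.w (CartesianMonoidalCategory.snd (projectiveSpace 1 ℂ) S)]; infer_instance
  haveI : LocallyOfFiniteType (projectiveSpace 1 ℂ ⊗ S).hom := inferInstance
  -- the thickened family `f_T : 𝒳 ×_S T ⟶ T` and its total space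
  set T : SchemeOver ℂ := projectiveSpace 1 ℂ ⊗ S
  set π : T ⟶ S := CartesianMonoidalCategory.snd (projectiveSpace 1 ℂ) S
  have hfT : IsSmoothProjectiveFamily (familyPullback.snd f π) A.dim := hf.familyPullback_snd π
  haveI : IrreducibleSpace (familyPullback f π).left := irreducibleSpace_of_isSmoothProjectiveFamily _ hfT
  haveI : AlgebraicGeometry.Smooth (familyPullback.snd f π).left := hfT.smooth
  haveI : IsProper (familyPullback.snd f π).left := hfT.isProper
  haveI : AlgebraicGeometry.Smooth (familyPullback f π).hom := by
    rw [← Over.w (familyPullback.snd f π)]; infer_instance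
  haveI : IsSeparated (familyPullback f π).hom := by
    rw [← Over.w (familyPullback.snd f π)]; infer_instance
  -- Step 2: two distinct points of `ℙ¹`, two points of `T` over `s₁`, `s₀`, two points of the total space
  obtain ⟨q₀⟩ := nonempty_complexPoints hP
  haveI := hP.smoothOfRelativeDimension
  haveI : AlgebraicGeometry.Smooth (projectiveSpace 1 ℂ).hom :=
    SmoothOfRelativeDimension.smooth 1 (projectiveSpace 1 ℂ).hom
  haveI : LocallyOfFiniteType (projectiveSpace 1 ℂ).hom := inferInstance
  obtain ⟨q₁, hq⟩ := exists_ne_of_smoothOfRelativeDimension_pos (projectiveSpace 1 ℂ) one_pos q₀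
  let t₁ : ComplexPoints T := CartesianMonoidalCategory.lift q₀ s₁
  let t₀ : ComplexPoints T := CartesianMonoidalCategory.lift q₁ s₀
  have ht₁ : AlgPoints.map π t₁ = s₁ := CartesianMonoidalCategory.lift_snd _ _
  have ht₀ : AlgPoints.map π t₀ = s₀ := CartesianMonoidalCategory.lift_snd _ _
  have ht : t₁ ≠ t₀ := by
    intro heq
    have h₁ : AlgPoints.map (CartesianMonoidalCategory.fst (projectiveSpace 1 ℂ) S) t₁ = q₀ :=
      CartesianMonoidalCategory.lift_fst _ _
    have h₀ : AlgPoints.map (CartesianMonoidalCategory.fst (projectiveSpace 1 ℂ) S) t₀ = q₁ :=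
      CartesianMonoidalCategory.lift_fst _ _
    exact hq (by rw [← h₀, ← h₁, heq])
  obtain ⟨A₁', -, ⟨j₁⟩⟩ := exists_abelianChart_familyPullback f π hab t₁
  obtain ⟨A₀', -, ⟨j₀⟩⟩ := exists_abelianChart_familyPullback f π hab t₀
  obtain ⟨P₁⟩ := nonempty_complexPoints (AbelianVariety.isSmoothProjective_holds (A := A₁'))
  obtain ⟨P₀⟩ := nonempty_complexPoints (AbelianVariety.isSmoothProjective_holds (A := A₀'))
  let y₁ : ComplexPoints (familyPullback f π) := AlgPoints.map (j₁.hom ≫ fiberι (familyPullback.snd f π) t₁) P₁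
  let y₀ : ComplexPoints (familyPullback f π) := AlgPoints.map (j₀.hom ≫ fiberι (familyPullback.snd f π) t₀) P₀
  have hy₁ : AlgPoints.map (familyPullback.snd f π) y₁ = t₁ := by
    change AlgPoints.map (familyPullback.snd f π)
      (AlgPoints.map (j₁.hom ≫ fiberι (familyPullback.snd f π) t₁) P₁) = t₁
    rw [AlgPoints.map_comp_apply, AlgPoints.map_map_fiberι]
  have hy₀ : AlgPoints.map (familyPullback.snd f π) y₀ = t₀ := by
    change AlgPoints.map (familyPullback.snd f π)
      (AlgPoints.map (j₀.hom ≫ fiberι (familyPullback.snd f π) t₀) P₀) = t₀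
    rw [AlgPoints.map_comp_apply, AlgPoints.map_map_fiberι]
  have hy : y₁ ≠ y₀ := fun heq => ht (by rw [← hy₁, ← hy₀, heq])
  -- Step 3: Mumford's curve through `y₁`, `y₀` in the irreducible smooth separated total space
  obtain ⟨D, γ, a, b, hDaff, hDirr, hDsm, -, ha, hb⟩ :=
    mumford_smoothCurve_through_two_points_of_isSeparated_of_smooth y₁ y₀ hy
  haveI := hDaff; haveI := hDirr; haveI := hDsm
  haveI : LocallyOfFiniteType D.hom := inferInstance
  -- the classifying map `h : D ⟶ S` and its lift `γ𝒳 : D ⟶ 𝒳`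
  set γ𝒳 : D ⟶ 𝒳 := γ ≫ familyPullback.fst f π with hγ𝒳
  set h : D ⟶ S := γ𝒳 ≫ f with hh
  have hha : AlgPoints.map h a = s₁ := by
    rw [hh, hγ𝒳, Category.assoc, familyPullback.condition, ← Category.assoc, AlgPoints.map_comp_apply,
      AlgPoints.map_comp_apply, ha, hy₁, ht₁]
  have hhb : AlgPoints.map h b = s₀ := by
    rw [hh, hγ𝒳, Category.assoc, familyPullback.condition, ← Category.assoc, AlgPoints.map_comp_apply,
      AlgPoints.map_comp_apply, hb, hy₀, ht₀]
  -- Step 4: the family over `D` has a section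
  have hF : IsSmoothProjectiveFamily (familyPullback.snd f h) A.dim := hf.familyPullback_snd h
  obtain ⟨eD, heD⟩ : ∃ eD : D ⟶ familyPullback f h, eD ≫ familyPullback.snd f h = 𝟙 D :=
    ⟨(familyPullback.isPullback f h).lift γ𝒳 (𝟙 D) (by rw [hh, Category.id_comp]),
      (familyPullback.isPullback f h).lift_snd _ _ _⟩
  have habD : ∀ u : ComplexPoints D, ∃ A' : AbelianVariety ℂ,
      A'.dim = A.dim ∧ Nonempty (A'.X ≅ fiberOver (familyPullback.snd f h) u) :=
    exists_abelianChart_familyPullback f h hab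
  -- Step 5: Raynaud ⟹ quasi-projective total space; the affine curve is quasi-projective
  have hQZ : IsQuasiProjectiveOver (familyPullback f h) :=
    Theorems.isQuasiProjectiveOver_of_isClosedImmersion_of_isAffine
      (hR (familyPullback.snd f h) eD heD hF.smooth hF.isProper hDaff hDsm fun u => by
        obtain ⟨A', -, hA'⟩ := habD u
        exact ⟨A', hA'⟩)
  have hQD : IsQuasiProjectiveOver D := IsQuasiProjectiveOver.of_isAffine D
  -- Step 6: transport and assemble
  obtain ⟨i, hi⟩ := exists_anchor_familyPullback_of_map_eq f h (2 * p) W hha e hWc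
  obtain ⟨i₀'⟩ := nonempty_fiberIso_familyPullback_of_map_eq f h hhb i₀
  refine ⟨D, familyPullback f h, familyPullback.snd f h, complexBetti.map (familyPullback.fst f h) (2 * p) W,
    a, b, i.hom ≫ fiberι (familyPullback.snd f h) a, A₀, i₀'.hom ≫ fiberι (familyPullback.snd f h) b,
    hQZ, hQD, hDsm, hDirr, hF, ⟨i, rfl⟩, ⟨i₀', rfl⟩, (isCM_iff_exists_cmSubalgebra A₀).2 hcm₀, hi, ?_⟩
  intro B eB u heB
  exact hodgeAlong_familyPullback f h hf W hW B eB u heB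

end Engine

/-! ## §3 Row b07 from row b01 over separated bases, modulo Raynaud -/

/-- **`MTAnchorsSep[] ⟹ CMAnchoredFamilies` modulo Raynaud 1970** — the converse of part XX (C) OVER SEPARATED
BASES: row b07 (quasi-projective base AND total space, CM fibre in the eigenvalue typing, Hodge clause on every
abelian presentation) from the row-b01 data over a separated base, the quasi-projectivity supplied by Raynaud's
theorem over a curve in the total space (engine). CONDITIONAL on `raynaud1970_abelianScheme_section_projective`.
[cite: GortzWedhorn2023, §(27.53) Thm. 27.291] [cite: LaurentSchroer2023, §4 Prop. 4.3] [cite: MumfordAV1970, §6 Lemma] -/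
theorem cmAnchoredFamilies_of_mtAnchorsSep_of_raynaud1970 (hR : raynaud1970_abelianScheme_section_projective)
    (h : MTAnchorsSep[]) : CMAnchoredFamilies := by
  intro A p c hc hpp
  exact cmAnchoredFor_of_sepAnchors_of_raynaud1970 hR
    (h A (AbelianVariety.isSmoothProjective_holds (A := A)) p c hc hpp)

/-- **Row b07 from Charles–Schnell Thm. 11.5.11 (a) + flat-section (b) + ONE CM fibre over a separated base,
modulo Raynaud 1970**: `MTFlatSep[] ⟹ CMAnchoredFamilies` (gen 8's `mtAnchorsCurve_of_flatSep`, `mtAnchorsSep_of_curve`,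
then §3) — the quasi-projectivity clauses of b07's print, the density of CM points and the global invariant cycle
theorem are NOT kernel inputs of row b07 once Raynaud XI 1.4 is granted. CONDITIONAL on the named fact.
[cite: CharlesSchnell2014Notes, Thm. 11.5.11 and its proof (pp. 516–518)] [cite: GortzWedhorn2023, §(27.53) Thm. 27.291] -/
theorem cmAnchoredFamilies_of_mtFlatSep_of_raynaud1970 (hR : raynaud1970_abelianScheme_section_projective)
    (h : MTFlatSep[]) : CMAnchoredFamilies :=
  cmAnchoredFamilies_of_mtAnchorsSep_of_raynaud1970 hR (mtAnchorsSep_of_curve (mtAnchorsCurve_of_flatSep h))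

/-! ## §4 The converse keeping separatedness, and the two-sided statements -/

/-- **`CMAnchoredFamilies ⟹ MTAnchorsSep[]` modulo Catanese 2002** — part XX (C)
(`Ring2.Deform.mumfordTateCMAnchors_of_cmAnchoredFamilies`) with the separatedness of the quasi-projective base
retained (`IsQuasiProjectiveOver.isSeparated`): every fibre is charted by an abelian variety of dimension `dim A`
(Catanese's theorem, named fact, a hypothesis), the Hodge clause is read off the chart, the CM typings agree.
CONDITIONAL on Catanese's theorem. [cite: Catanese2002DeformationTypes, Thm. 4.1 and Thm. 4.6] [cite: MumfordAV1970, §22] -/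
theorem mtAnchorsSep_of_cmAnchoredFamilies_of_catanese2002 (hCat : catanese2002_abelianFibres_of_abelianFibre)
    (h : CMAnchoredFamilies) : MTAnchorsSep[] := by
  intro A _ p c hc hpp
  obtain ⟨S, 𝒳, f, G, t, s₀, e, A₀, e₀, hQ𝒳, hQS, hsm, hirr, hf, ⟨i, rfl⟩, ⟨i₀, rfl⟩, hcm, hGc, hHA⟩ :=
    h A p c hc hpp
  have hab : ∀ s : ComplexPoints S, ∃ A' : AbelianVariety ℂ, A'.dim = A.dim ∧ Nonempty (A'.X ≅ fiberOver f s) :=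
    hCat f A hQ𝒳 hQS hirr hsm hf ⟨t, ⟨i⟩⟩
  have hW : ∀ s : ComplexPoints S, IsRationalClass (complexBetti.map (fiberι f s) (2 * p) G) ∧
      IsOfHodgeType A.dim (fiberOver f s) (2 * p) p p (complexBetti.map (fiberι f s) (2 * p) G) := by
    intro s
    obtain ⟨A', hdim', ⟨j⟩⟩ := hab s
    have h' := hHA A' (j.hom ≫ fiberι f s) s ⟨j, rfl⟩
    rw [complexBetti.map_comp, CategoryTheory.comp_apply, hdim'] at h'
    exact ⟨(isRationalClass_map_iff_of_iso j).1 h'.1, (isOfHodgeType_map_iff_of_iso j).1 h'.2⟩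
  have hdim₀ : A₀.dim = A.dim := schemeDim_eq_holds ((hf.isSmoothProjective s₀).of_iso i₀.symm)
  rw [complexBetti.map_comp, CategoryTheory.comp_apply] at hGc
  exact ⟨𝒳, S, f, t, s₀, i, G, A₀, hf, hirr, hsm, IsQuasiProjectiveOver.isSeparated hQS, hab, hW, hGc, hdim₀,
    ⟨i₀⟩, (isCM_iff_exists_cmSubalgebra A₀).1 hcm⟩

/-- **Rows b01 (separated bases) and b07 are ONE ROW modulo the booked facts {Raynaud 1970, Catanese 2002}:
`MTAnchorsSep[] ↔ CMAnchoredFamilies`.** CONDITIONAL on both named facts (hypotheses; neither discharged).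
[cite: GortzWedhorn2023, §(27.53) Thm. 27.291] [cite: Catanese2002DeformationTypes, Thm. 4.1 and Thm. 4.6]
[cite: Deligne1982HodgeCycles, Prop. 6.1] -/
theorem mtAnchorsSep_iff_cmAnchoredFamilies_of_raynaud1970_of_catanese2002
    (hR : raynaud1970_abelianScheme_section_projective) (hCat : catanese2002_abelianFibres_of_abelianFibre) :
    MTAnchorsSep[] ↔ CMAnchoredFamilies :=
  ⟨cmAnchoredFamilies_of_mtAnchorsSep_of_raynaud1970 hR, mtAnchorsSep_of_cmAnchoredFamilies_of_catanese2002 hCat⟩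

/-- **… hence `MTFlatSep[] ↔ CMAnchoredFamilies`** modulo the same two facts (through row b01's curve form, gen 8's
`mtAnchorsCurve_iff_flatSep`, `mtAnchorsCurve_iff_sep`): CS Thm. 11.5.11 (a) + flat (b) + one CM fibre over a
separated base says exactly as much as the CM-pivot's anchor node, granted Raynaud and Catanese.
[cite: CharlesSchnell2014Notes, Thm. 11.5.11] [cite: Catanese2002DeformationTypes, Thm. 4.1 and Thm. 4.6] -/
theorem mtFlatSep_iff_cmAnchoredFamilies_of_raynaud1970_of_catanese2002
    (hR : raynaud1970_abelianScheme_section_projective) (hCat : catanese2002_abelianFibres_of_abelianFibre) :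
    MTFlatSep[] ↔ CMAnchoredFamilies :=
  mtAnchorsCurve_iff_flatSep.symm.trans
    (mtAnchorsCurve_iff_sep.trans (mtAnchorsSep_iff_cmAnchoredFamilies_of_raynaud1970_of_catanese2002 hR hCat))

end Summit.HodgeConjecture.HodgeConjecture.Ring2.Hypotheses

end
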